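import Summits.CriticalPhenomena.PercolationContinuityZ3.Theorems.PercNearOneGluingNoHeavyLowerTailSunflowerRainbowLinearDichotomyRefutation
import Summits.CriticalPhenomena.PercolationContinuityZ3.Theorems.PercNearOneGluingNoHeavyLowerTailSunflowerRainbowCertificate
import HarnessLib
import HarnessLib.Audit

/-!
# `NoHeavyLowerTail` (crux stmt-CriticalPhenomena-4575), abstract sunflower cubic: `RainbowCertificate` (gen 23) is FALSE

Support file (seat `prim-l12-p2` gen 25; `--supports stmt-CriticalPhenomena-4575`).  One-line corollary of `not_rainbowLinearDichotomy`
(`…SunflowerRainbowLinearDichotomyRefutation`, the seven-point witness) and gen 23's reduction `rainbowLinearDichotomy_of_rainbowCertificate`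
(`…SunflowerRainbowCertificate`): a ⊴-unitriangular mixed Gram certificate would give the linear-extension dichotomy for EVERY linear extension,
which the witness violates.  Memo: run/shared/lean/prim/prim-l12/prim-l12-p2/FINDING-g25-ADVERSARIAL-CENSUS-AND-STRUCTURE.md §1.
-/

namespace Summit.CriticalPhenomena.PercolationContinuityZ3.Theorems.SunflowerPartition

/-- **`RainbowCertificate` is false.** [this work] -/
theorem not_rainbowCertificate : ¬ RainbowCertificate := fun h =>
  not_rainbowLinearDichotomy (rainbowLinearDichotomy_of_rainbowCertificate h)

end Summit.CriticalPhenomena.PercolationContinuityZ3.Theorems.SunflowerPartition
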